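import Literature.NumberTheory.Transcendental.KaehlerHodgeConjProofs
import Literature.NumberTheory.Transcendental.KaehlerHodgeConjCounterexample
import HarnessLib

/-!
# The named fact `dolbeaultLaplacian_eq_delLaplacian` is false as stated (`Δ_∂̄ α = 0 ≠ Δ_∂ α` on the rigged `ℂ²`)

Theorems-only companion of `Literature/NumberTheory/Transcendental/KaehlerHodge.lean` (C12), of
`KaehlerHodgeConjProofs.lean` (the unconditional conjugation plumbing `Δ_∂̄ ᾱ = \overline{Δ_∂ α}`),
of `KaehlerHodgeConjCounterexample.lean` (the model `OriginSwapAtlas.Mc2`) and of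
`KaehlerHodgeDelLaplacianFact.lean` (the corrected statement
`dolbeaultLaplacian_eq_delLaplacian_of_isManifold_complex`).

`KaehlerHodge.lean` renders the Kähler identity `Δ_∂̄ = Δ_∂` (Voisin (2002), §6.1.2, Thm. 6.7,
p. 141: "Let `(X, ω)` be a Kähler manifold … `Δ_∂ = Δ_∂̄ = ½Δ_d`", proved from the first-order
identities `[Λ, ∂̄] = -i∂*`, `[Λ, ∂] = i∂̄*` of Prop. 6.5; Huybrechts (2005), Prop. 3.1.12 (iii);
Griffiths–Harris (1978), p. 115) as the named fact
`Literature.NumberTheory.Transcendental.dolbeaultLaplacian_eq_delLaplacian g o`, a `def … : Prop`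
written in `section Kaehler` after `variable … [IsManifold 𝓘(ℂ, E) ω M] [IsManifold 𝓘(ℝ, E) ∞ M]
(g …) (o …)`.

**Finding (kernel-checked here; recorded informally in `KaehlerHodgeDelLaplacianFact.lean`).** The body
mentions `g` (hence the real tangent bundle and `[IsManifold 𝓘(ℝ, E) ∞ M]`) but nothing in it uses the
*complex*-manifold instance, so Lean did not abstract it: `#check @dolbeaultLaplacian_eq_delLaplacian`
lists `{E} [NormedAddCommGroup E] [NormedSpace ℂ E] {M} [TopologicalSpace M] [ChartedSpace E M]
{k m : ℕ} [FiniteDimensional ℂ E] {n : ℕ} [Fact (finrank ℝ E = n)] [IsManifold 𝓘(ℝ, E) ∞ M] (g) (o)`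
as its only binders — the accident shared by its siblings `cHodgeLaplacian_eq_two_smul_dolbeaultLaplacian`,
`dolbeaultHarmonicForms_conj`, `typeComponent_mem_charmonicForms`,
`dolbeaultHarmonicForms_le_charmonicForms` (all documented in `KaehlerHodge.lean`). The fact is
therefore stated for every *real* `C^∞` manifold charted in `E`, the "complex structure" being
multiplication by `i` in the coordinates of the preferred chart `chartAt x` — not a tensor unless the
transition maps are holomorphic —, and with it `typeComponent`, `∂`, `∂̄`, `∂* = -⋆∂̄⋆`,
`∂̄* = -⋆∂⋆`, `Δ_∂̄` and `Δ_∂` are read chart-wise. In that generality the statement is **false**: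

* `OriginSwapAtlas.not_dolbeaultLaplacian_eq_delLaplacian_Mc2` — it fails for the model
  `(Mc2, metric, orient)` of `KaehlerHodgeConjCounterexample.lean`: a copy of `ℂ²` with the
  real-smooth, non-holomorphic atlas `{id, A}`, `A(z, w) = (z, w̄)` preferred at the origin only, the
  flat metric (a `C^∞` metric, Hermitian, and Kähler in the sense of `IsKaehler`,
  `OriginSwapAtlas.isKaehler`) and the chart-wise orientation (smooth volume form,
  `OriginSwapAtlas.isSmoothForm_riemannianVolumeForm`), in degree `k = 1` (`m = 3`, `n = 4`);
* `not_forall_dolbeaultLaplacian_eq_delLaplacian` — the closure over real `C^∞` fourfolds charted in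
  `ℂ²`; and
* `not_dolbeaultLaplacian_eq_delLaplacian` — the universal closure over *exactly* the binders the fact
  elaborates with; hence no closed proof `dolbeaultLaplacian_eq_delLaplacian_holds` can exist.

**The witness** is the smooth `1`-form `α = (z̄ + 1) w̄ dz` of that file (`OriginSwapAtlas.alpha`): it
is `∂̄`-harmonic of type `(1,0)` (`OriginSwapAtlas.isDolbeaultHarmonic_alpha`: `∂̄*α = 0` by types
and `∂̄*∂̄α = 0`, the representative of `⋆∂̄α` jumping at the rigged origin so that its `mextDeriv`
there is Mathlib's junk `0`), so `Δ_∂̄ α = 0` (`OriginSwapAtlas.dolbeaultLaplacian_alpha`, same file); but `Δ_∂ α ≠ 0`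
(`delLaplacian_alpha_ne_zero`). Indeed `Δ_∂ α = \overline{Δ_∂̄ ᾱ}` for *any* metric
(`delLaplacian_conj`, `KaehlerHodgeConjProofs.lean`), and `Δ_∂̄ ᾱ ≠ 0`
(`dolbeaultLaplacian_alphaBar_ne_zero`): otherwise `ᾱ = (z + 1) w dz̄` — smooth and of type
`(0,1)` — would be `∂̄`-harmonic of type `(0,1)`, hence in the `ℂ`-span `ℋ^{0,1}`, which lies in
the kernel of the linear functional `L` of that file (`OriginSwapAtlas.dolbeaultHarmonicForms_le_Tsub`:
`L` reads the `dw̄`-coefficient of `∂̄∂̄*β` at the origin and vanishes on every `∂̄`-harmonic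
`(0,1)`-form), whereas `L(ᾱ) = 4` (`OriginSwapAtlas.Lfun_alphaBar`). (The same mechanism, through
the bridge `dolbeaultHarmonicForms_conj_of_dolbeaultLaplacian_eq_delLaplacian` of
`KaehlerHodgeConjProofs.lean`, which does not use the holomorphic atlas, gives a second proof of
`not_dolbeaultLaplacian_eq_delLaplacian_Mc2` from `OriginSwapAtlas.not_dolbeaultHarmonicForms_conj_Mc2`;
recorded as `OriginSwapAtlas.not_dolbeaultLaplacian_eq_delLaplacian_Mc2'`.) The witness is
four-dimensional only because it reuses the model `Mc2`, the form `α` and the functional `L` that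
`KaehlerHodgeConjCounterexample.lean` built for `dolbeaultHarmonicForms_conj`; whether the mis-stated
identity already fails on a rigged *surface* (for forms of mixed type) is not examined here, and no
informal lower-dimensional example is relied upon.

Every identity used holds at every point; the only junk values are the ones the fact itself feeds
into `IsKaehler` and `Δ_∂̄` (it quantifies over this real-smooth, non-holomorphic atlas).

**What this does not touch.** The intended statement carries the complex-manifold hypothesis; it is
the corrected named fact `dolbeaultLaplacian_eq_delLaplacian_of_isManifold_complex g o`
(`KaehlerHodgeDelLaplacianFact.lean`: `[IsManifold 𝓘(ℂ, E) ω M]` a binder of the `def`, body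
verbatim, same citation), reduced there and in `KaehlerHodgeLaplacianProofs.lean` to the first-order
Kähler identities `KaehlerIdentities o Λ` for the contraction `Λ = ⋆⁻¹L⋆` of a Kähler metric
(Voisin (2002), Prop. 6.5 with Lemma 6.6 and Prop. 3.14) — a genuine theorem, not yet in the tree.
`Mc2` is of course not a complex manifold for its rigged atlas (the corrected fact says nothing
about it). No definition and no named fact is introduced here.

## References

* C. Voisin, *Hodge Theory and Complex Algebraic Geometry I*, Cambridge Studies in Advanced
  Mathematics 76 (2002), §6.1.1 Prop. 6.5, Lemma 6.6 (pp. 139–140); §6.1.2 Thm. 6.7 (p. 141) — the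
  intended (Kähler, hence complex-manifold) statement. [cite: Voisin2002, §6.1.2 Thm. 6.7]
* D. Huybrechts, *Complex Geometry. An Introduction*, Universitext (2005), §3.1, Prop. 3.1.12 (iii);
  §3.2, Remarks 3.2.7 (i). [cite: Huybrechts2005, Prop. 3.1.12 (iii)]
* P. Griffiths, J. Harris, *Principles of Algebraic Geometry* (1978), p. 115.
-/

noncomputable section

open scoped Manifold ContDiff ComplexConjugate
open Bundle Module
open Literature.Geometry.Kaehler

namespace Literature.NumberTheory.Transcendental

namespace OriginSwapAtlas

section WithMetric

/-! The metric of `Mc2` is the `def` `OriginSwapAtlas.bundle` (deliberately not a global instance, as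
in `KaehlerHodgeConjCounterexample.lean`); it is installed statement-wise by `letI`. -/

/-- **`Δ_∂̄ ᾱ ≠ 0`** for `ᾱ = (z + 1) w dz̄`: otherwise `ᾱ` (smooth, of type `(0,1)`) would be
`∂̄`-harmonic of type `(0,1)`, hence in `ℋ^{0,1} ≤ T = ker L` (`dolbeaultHarmonicForms_le_Tsub`),
contradicting `L(ᾱ) = 4` (`alphaBar_not_mem_Tsub`). [folklore] -/
theorem dolbeaultLaplacian_alphaBar_ne_zero :
    letI := bundle; dolbeaultLaplacian orient 1 3 h13 alphaBar ≠ 0 := by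
  letI := bundle
  intro h0
  have hh : IsDolbeaultHarmonic orient 0 1 h13 alphaBar :=
    ⟨isSmoothForm_alphaBar, (isDolbeaultHarmonic_alpha h13).2.1.conj, h0⟩
  exact alphaBar_not_mem_Tsub (dolbeaultHarmonicForms_le_Tsub hh.mem_dolbeaultHarmonicForms)

/-- **`Δ_∂ α ≠ 0`** for `α = (z̄ + 1) w̄ dz`: `Δ_∂̄ ᾱ = \overline{Δ_∂ α}` for any metric
(`dolbeaultLaplacian_conj`) and `Δ_∂̄ ᾱ ≠ 0`. [folklore] -/
theorem delLaplacian_alpha_ne_zero : letI := bundle; delLaplacian orient 1 3 h13 alpha ≠ 0 := by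
  letI := bundle
  intro h0
  apply dolbeaultLaplacian_alphaBar_ne_zero
  rw [alphaBar, dolbeaultLaplacian_conj, h0, MForm.conj_zero]

/-- **`Δ_∂̄ α ≠ Δ_∂ α`** on `(Mc2, metric, orient)` for the smooth `1`-form `α = (z̄ + 1) w̄ dz`
(`Δ_∂̄ α = 0`, `dolbeaultLaplacian_alpha`; `Δ_∂ α ≠ 0`, `delLaplacian_alpha_ne_zero`). [folklore] -/
theorem dolbeaultLaplacian_alpha_ne_delLaplacian_alpha :
    letI := bundle; dolbeaultLaplacian orient 1 3 h13 alpha ≠ delLaplacian orient 1 3 h13 alpha := by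
  letI := bundle
  rw [dolbeaultLaplacian_alpha h13]
  exact fun h ↦ delLaplacian_alpha_ne_zero h.symm

/-- **`dolbeaultLaplacian_eq_delLaplacian` fails for `(M, g, o) = (Mc2, metric, orient)`** in degree
`k = 1` (`m = 3`, `n = 4`): the metric is Kähler in the sense of `IsKaehler`, the volume form of
`orient` is smooth and `α = (z̄ + 1) w̄ dz` is smooth, yet `Δ_∂̄ α = 0 ≠ Δ_∂ α`. [folklore] -/
theorem not_dolbeaultLaplacian_eq_delLaplacian_Mc2 :
    ¬ dolbeaultLaplacian_eq_delLaplacian (k := 1) (m := 3) metric orient := by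
  letI := bundle
  exact fun H ↦ dolbeaultLaplacian_alpha_ne_delLaplacian_alpha
    (H isKaehler h13 isSmoothForm_alpha isSmoothForm_riemannianVolumeForm)

/-- Second proof of `not_dolbeaultLaplacian_eq_delLaplacian_Mc2`, through the sibling fact: by the
bridge `dolbeaultHarmonicForms_conj_of_dolbeaultLaplacian_eq_delLaplacian` (which holds instance-wise,
without a holomorphic atlas) the identity `Δ_∂̄ = Δ_∂` for `(Mc2, metric, orient)` would give
`\overline{ℋ^{1,0}} = ℋ^{0,1}` there, refuted by `not_dolbeaultHarmonicForms_conj_Mc2`. [folklore] -/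
theorem not_dolbeaultLaplacian_eq_delLaplacian_Mc2' :
    ¬ dolbeaultLaplacian_eq_delLaplacian (k := 1) (m := 3) metric orient :=
  fun H ↦ not_dolbeaultHarmonicForms_conj_Mc2
    (dolbeaultHarmonicForms_conj_of_dolbeaultLaplacian_eq_delLaplacian metric orient H)

end WithMetric

end OriginSwapAtlas

section UniversalClosure

open OriginSwapAtlas

/-- **`dolbeaultLaplacian_eq_delLaplacian` cannot be discharged as stated**: its closure over real
`C^∞` fourfolds charted in `ℂ²` (smooth metric, any orientation family) is false in degree `k = 1`,
`m = 3` — witness `Mc2` with the flat metric (`not_dolbeaultLaplacian_eq_delLaplacian_Mc2`). The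
intended statement is Voisin (2002), §6.1.2, Thm. 6.7, for Kähler — in particular complex —
manifolds. [folklore] -/
theorem not_forall_dolbeaultLaplacian_eq_delLaplacian :
    ¬ ∀ (M : Type) [TopologicalSpace M] [ChartedSpace (ℂ × ℂ) M] [IsManifold 𝓘(ℝ, ℂ × ℂ) ∞ M]
        (g : Bundle.ContMDiffRiemannianMetric 𝓘(ℝ, ℂ × ℂ) ∞ (ℂ × ℂ) (fun x : M ↦ TangentSpace 𝓘(ℝ, ℂ × ℂ) x))
        (o : (x : M) → Orientation ℝ (TangentSpace 𝓘(ℝ, ℂ × ℂ) x) (Fin 4)),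
        Literature.NumberTheory.Transcendental.dolbeaultLaplacian_eq_delLaplacian (k := 1) (m := 3) g o :=
  fun H ↦ not_dolbeaultLaplacian_eq_delLaplacian_Mc2 (H Mc2 metric orient)

/-- **The named fact `dolbeaultLaplacian_eq_delLaplacian` is false as stated.** Closed universally over
exactly the binders it elaborates with — a finite-dimensional complex normed space `E` with
`finrank ℝ E = n`, a charted space `M` over `E` that is a *real* `C^∞` manifold (no
`[IsManifold 𝓘(ℂ, E) ω M]`: the section instance is not mentioned in the body of the `def` and was
therefore not abstracted), degrees `k`, `m`, a `C^∞` Riemannian metric `g` and an orientation family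
`o` — the statement fails: witness `E = ℂ × ℂ`, `n = 4`, `k = 1`, `m = 3`, `M = Mc2` (the `{id, A}`-rigged
copy of `ℂ²`, `A(z, w) = (z, w̄)` preferred at the origin), the flat (Kähler) metric and the chart-wise
orientation (`OriginSwapAtlas.not_dolbeaultLaplacian_eq_delLaplacian_Mc2`). Hence no closed proof
`dolbeaultLaplacian_eq_delLaplacian_holds` can exist. The intended statement — Voisin (2002), §6.1.2,
Thm. 6.7; Huybrechts (2005), Prop. 3.1.12 (iii) — carries the complex-manifold hypothesis; it is the
corrected named fact `dolbeaultLaplacian_eq_delLaplacian_of_isManifold_complex`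
(`KaehlerHodgeDelLaplacianFact.lean`). [folklore] -/
theorem not_dolbeaultLaplacian_eq_delLaplacian :
    ¬ ∀ {E : Type} [NormedAddCommGroup E] [NormedSpace ℂ E] {M : Type} [TopologicalSpace M]
        [ChartedSpace E M] {k m : ℕ} [FiniteDimensional ℂ E] {n : ℕ} [Fact (finrank ℝ E = n)]
        [IsManifold 𝓘(ℝ, E) ∞ M]
        (g : Bundle.ContMDiffRiemannianMetric 𝓘(ℝ, E) ∞ E (fun x : M ↦ TangentSpace 𝓘(ℝ, E) x))
        (o : (x : M) → Orientation ℝ (TangentSpace 𝓘(ℝ, E) x) (Fin n)),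
        Literature.NumberTheory.Transcendental.dolbeaultLaplacian_eq_delLaplacian (k := k) (m := m) g o :=
  fun H ↦ not_dolbeaultLaplacian_eq_delLaplacian_Mc2
    (@H (ℂ × ℂ) _ _ Mc2 _ _ 1 3 _ 4 fact_finrank _ metric orient)

end UniversalClosure

end Literature.NumberTheory.Transcendental
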